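import Summits.ResolutionOfSingularities.ResolutionOfSingularities.Theorems.FrobeniusClosingSteerHatFiniteEtale
import Mathlib.FieldTheory.Minpoly.Field
import Mathlib.RingTheory.MvPolynomial.Homogeneous
import HarnessLib

/-!
# Crux `Steer` (stmt-ResolutionOfSingularities-16345), chain W4.1 — `HatBaseChangeX` infrastructure, part 2:
# the chart map FACTORS through `S′ = S[T]/(m̃)` and the bookkeeping clauses of the β-slot `HatBaseChangeX`

OURS (campaign `res-hironaka`, rung L ★L-G4, slot W4.1; seat res-L0-w41-stub-4 g7 on res-L0-w41-plan-1 RULING 196d). Replaces the role of no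
printed item; NOT a statement of the manuscript under review [claim: Hironaka2017, status: under-review]; AI-produced, weaker than expert review.
Theses-free, definition-free, WORDS-FREE: the β-leaf words `IsHatRing` / `IsXChartHat` / `IsArithStage` (res-L0-w41-idea-1 v18.4-J4K7 §2♯/§5) are
not tree declarations yet, so every clause is stated UNBUNDLED in the words' verbatim shape; the 20-line word-level wrapper `hatBaseChangeX_…` follows
the words file.

SETTING (continuing part 1 `…HatFiniteEtale`): `φ : S →+* S₁` with coefficient-field sections `σ, σ₁`, compatibility
`φ (σ a) = σ₁ (residue₁ (φ (σ a)))`, `κ₁ = κ[c]` for the chart point `c : κ₁`, and the x-chart substitutions; `ī := residue₁ ∘ φ ∘ σ : κ → κ₁`.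
* `exists_residueField_ringEquiv` — EXPLICIT `e : κ′ ≃+* κ[T]/(m)` (`e (residue′ (ι s)) = of (residue s)`, `e (residue′ θ) = root m`);
  `exists_polynomial_map_ne_zero_eval_eq_zero` — `κ′` is algebraic over `S` (clause 6 of the word).
* `isIntegral_chartPoint` — `κ₁ = κ[c]` a field ⇒ `c` algebraic; `eval₂_map_minpoly_chartPoint` — the `σ`-lift of `minpoly κ c` has the root `σ₁ c`
  under `φ` EXACTLY (`φ ∘ σ = σ₁ ∘ ī`; no Hensel lifting).
* `chart_clauses` — for any monic irreducible `m` with that root property, `φ′ := AdjoinRoot.lift φ (σ₁ c)` and a compatible section `σ′` give: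
  `φ′ ∘ ι = φ`, `ι` local, `(ι x, ι y, ι z, ι w) = 𝔪′`, `ι ∘ σ ⊆ σ′ κ′`, algebraicity, `residue₁ ∘ φ′ ∘ σ′ : κ′ → κ₁` BIJECTIVE, the eight clauses of
  `IsXChartHat φ′ σ′ σ₁ (ι x) (ι y) (ι z) (ι w) c v₁ z₁ w₁` (same chart point), and RATIONALITY of the point over `S′`.
* `hatRing_clauses_adjoinRoot_section` — the five `IsHatRing` clauses for `S′`; `charP_adjoinRoot_section`.
* `stage_congruence_map` — the stage congruence `f ≡ Ψ(z,w) (mod (x,y)·𝔪^(d−1) + 𝔪^(d+1))` transports to `ι f`, `Ψ^ι` in `S′`;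
  `anisotropic_map_of_anisotropic_baseChange` — anisotropy of `Ψ̄^ι` over `κ′` ⇐ anisotropy of `Ψ̄ ⊗_ī κ₁` over `κ₁` (along the bijection).
WHAT IS LEFT of the word `HatBaseChangeX` after parts 1–2: ONLY «`Ψ̄ ⊗_ī κ₁` is anisotropic over `κ₁`», to be extracted from the binder
`IsArithStage S₁ …` and the radicand relation by a coefficient computation in Cohen coordinates of `S₁` (cone persistence) — reported on the bus.

[cite: Matsumura1987, Thm. 28.3; proof of Thm. 29.1] [folklore]
bears_on: LADDER-RESOLUTION L ★L-G4 W4.1 (crux `Steer`, binder hK4ⁿᶜ, β-slot `HatBaseChangeX`).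
-/

noncomputable section

-- `Summit.<S>.<S>.…` duplicates the summit name by design (single-problem summit).
set_option linter.dupNamespace false

open IsLocalRing Polynomial

namespace Summit.ResolutionOfSingularities.ResolutionOfSingularities.Theorems.SwitchingDichotomy.HatBaseChange

/-! ## §6 The residue field of `S′` with its values on generators; algebraicity -/

section ResidueIso
variable {S : Type} [CommRing S] [IsLocalRing S] (σ : ResidueField S →+* S) (hσ : ∀ a, residue S (σ a) = a)
  (m : Polynomial (ResidueField S))

include hσ in
/-- **Explicit residue-field isomorphism** `e : κ′ ≃ κ[T]/(m)` with `e (residue (ι s)) = of (residue s)` and `e (residue θ) = root m`. -/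
theorem exists_residueField_ringEquiv (hm : m.Monic) (hirr : Irreducible m) :
    haveI := isLocalRing_adjoinRoot_section σ hσ m hm hirr
    ∃ e : ResidueField (AdjoinRoot (m.map σ)) ≃+* AdjoinRoot m,
      (∀ s : S, e (residue _ (AdjoinRoot.of (m.map σ) s)) = AdjoinRoot.of m (residue S s)) ∧
      e (residue _ (AdjoinRoot.root (m.map σ))) = AdjoinRoot.root m := by
  haveI := isLocalRing_adjoinRoot_section σ hσ m hm hirr
  have hmax := maximalIdeal_adjoinRoot_section σ hσ m hm hirr
  let τ : AdjoinRoot m →+* AdjoinRoot (m.map σ) :=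
    AdjoinRoot.lift ((AdjoinRoot.of (m.map σ)).comp σ) (AdjoinRoot.root (m.map σ)) (eval₂_of_comp_section_root σ m)
  let ψ : AdjoinRoot (m.map σ) →+* AdjoinRoot m :=
    AdjoinRoot.lift ((AdjoinRoot.of m).comp (residue S)) (AdjoinRoot.root m) (eval₂_of_comp_residue_root σ hσ m)
  have hψ : ∀ a ∈ maximalIdeal (AdjoinRoot (m.map σ)), ψ a = 0 := by
    intro a ha
    rw [hmax] at ha
    have hle : (maximalIdeal S).map (AdjoinRoot.of (m.map σ)) ≤ RingHom.ker ψ := by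
      rw [Ideal.map_le_iff_le_comap]
      intro c hc
      rw [Ideal.mem_comap, RingHom.mem_ker]
      change AdjoinRoot.lift _ _ _ (AdjoinRoot.of (m.map σ) c) = 0
      rw [AdjoinRoot.lift_of, RingHom.comp_apply, (IsLocalRing.residue_eq_zero_iff c).mpr hc, map_zero]
    exact hle ha
  let ψbar : ResidueField (AdjoinRoot (m.map σ)) →+* AdjoinRoot m :=
    Ideal.Quotient.lift (maximalIdeal (AdjoinRoot (m.map σ))) ψ hψ
  have hψbar : ∀ a, ψbar (residue _ a) = ψ a := fun a => Ideal.Quotient.lift_mk _ _ _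
  let τbar : AdjoinRoot m →+* ResidueField (AdjoinRoot (m.map σ)) := (residue _).comp τ
  -- the two composites are identities
  have h1 : ∀ b, τbar (ψbar b) = b := by
    intro b
    obtain ⟨a, rfl⟩ := Ideal.Quotient.mk_surjective b
    obtain ⟨g, rfl⟩ := AdjoinRoot.mk_surjective a
    change residue _ (τ (ψbar (residue _ (AdjoinRoot.mk (m.map σ) g)))) = residue _ (AdjoinRoot.mk (m.map σ) g)
    rw [hψbar]
    change residue _ (τ (AdjoinRoot.lift _ _ _ (AdjoinRoot.mk (m.map σ) g))) = _
    rw [lift_mk_eq_mk_map]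
    change residue _ (AdjoinRoot.lift _ _ _ (AdjoinRoot.mk m _)) = _
    rw [lift_mk_eq_mk_map, Polynomial.map_map, ← sub_eq_zero, ← map_sub, IsLocalRing.residue_eq_zero_iff, hmax]
    exact mk_map_sub_mk_mem (m.map σ) (σ.comp (residue S)) (fun c => by
      rw [← IsLocalRing.residue_eq_zero_iff, map_sub, RingHom.comp_apply, hσ, sub_self]) g
  have h2 : ∀ q, ψbar (τbar q) = q := by
    intro q
    obtain ⟨g, rfl⟩ := AdjoinRoot.mk_surjective q
    change ψbar (residue _ (τ (AdjoinRoot.mk m g))) = _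
    rw [hψbar]
    change ψ (AdjoinRoot.lift _ _ _ (AdjoinRoot.mk m g)) = _
    rw [lift_mk_eq_mk_map]
    change AdjoinRoot.lift _ _ _ (AdjoinRoot.mk (m.map σ) _) = _
    rw [lift_mk_eq_mk_map, Polynomial.map_map]
    have : (residue S).comp σ = RingHom.id _ := RingHom.ext hσ
    rw [this, Polynomial.map_id]
  let e : ResidueField (AdjoinRoot (m.map σ)) ≃+* AdjoinRoot m :=
    RingEquiv.ofRingHom ψbar τbar (RingHom.ext h2) (RingHom.ext h1)
  refine ⟨e, fun s => ?_, ?_⟩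
  · change ψbar (residue _ (AdjoinRoot.of (m.map σ) s)) = _
    rw [hψbar]
    change AdjoinRoot.lift _ _ _ (AdjoinRoot.of (m.map σ) s) = _
    rw [AdjoinRoot.lift_of, RingHom.comp_apply]
  · change ψbar (residue _ (AdjoinRoot.root (m.map σ))) = _
    rw [hψbar]
    change AdjoinRoot.lift _ _ _ (AdjoinRoot.root (m.map σ)) = _
    rw [AdjoinRoot.lift_root]

include hσ in
/-- Every element of the residue field `κ′` of `S′` is ALGEBRAIC over the image of `S`: it is killed by the image of a polynomial over `S`
whose reduction is nonzero (indeed monic). -/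
theorem exists_polynomial_map_ne_zero_eval_eq_zero (hm : m.Monic) (hirr : Irreducible m) :
    haveI := isLocalRing_adjoinRoot_section σ hσ m hm hirr
    ∀ b : ResidueField (AdjoinRoot (m.map σ)), ∃ P : Polynomial S,
      P.map ((residue (AdjoinRoot (m.map σ))).comp (AdjoinRoot.of (m.map σ))) ≠ 0 ∧
      (P.map ((residue (AdjoinRoot (m.map σ))).comp (AdjoinRoot.of (m.map σ)))).eval b = 0 := by
  haveI := isLocalRing_adjoinRoot_section σ hσ m hm hirr
  haveI : Fact (Irreducible m) := ⟨hirr⟩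
  haveI : Module.Finite (ResidueField S) (AdjoinRoot m) := hm.finite_adjoinRoot
  obtain ⟨e, he_of, -⟩ := exists_residueField_ringEquiv σ hσ m hm hirr
  intro b
  -- `e b` is integral over `κ`
  have hint : IsIntegral (ResidueField S) (e b) := Algebra.IsIntegral.isIntegral (R := ResidueField S) (e b)
  obtain ⟨p, hpmonic, hpeval⟩ := hint
  refine ⟨p.map σ, ?_, ?_⟩
  · rw [Polynomial.map_map]
    exact (hpmonic.map _).ne_zero
  · -- apply `e`: `e ((p.map (residue′ ∘ ι ∘ σ)).eval b) = p.eval₂ (algebraMap κ (AdjoinRoot m)) (e b) = 0`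
    apply e.injective
    rw [map_zero, Polynomial.map_map, Polynomial.eval_map]
    change e.toRingHom (Polynomial.eval₂ _ b p) = 0
    rw [Polynomial.hom_eval₂]
    have hcomp : e.toRingHom.comp (((residue (AdjoinRoot (m.map σ))).comp (AdjoinRoot.of (m.map σ))).comp σ) =
        algebraMap (ResidueField S) (AdjoinRoot m) := by
      refine RingHom.ext fun a => ?_
      change e (residue _ (AdjoinRoot.of (m.map σ) (σ a))) = algebraMap (ResidueField S) (AdjoinRoot m) a
      rw [he_of, hσ, AdjoinRoot.algebraMap_eq]
    rw [hcomp]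
    exact hpeval

end ResidueIso

/-! ## §7 The chart map factors: `φ′ := AdjoinRoot.lift φ (σ₁ c)` and the bookkeeping clauses of `HatBaseChangeX` -/

section Chart
variable {S S₁ : Type} [CommRing S] [IsLocalRing S] [CommRing S₁] [IsLocalRing S₁]
  (φ : S →+* S₁) (σ : ResidueField S →+* S) (σ₁ : ResidueField S₁ →+* S₁)
  (x y z w : S) (c : ResidueField S₁) (v₁ z₁ w₁ : S₁)

/-- Under coefficient-field compatibility, `φ ∘ σ = σ₁ ∘ ī` with `ī = residue₁ ∘ φ ∘ σ : κ → κ₁` the residue-field map. -/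
theorem comp_section_eq_of_compat (hcompat : ∀ a, φ (σ a) = σ₁ (residue S₁ (φ (σ a)))) :
    φ.comp σ = σ₁.comp ((residue S₁).comp (φ.comp σ)) :=
  RingHom.ext fun a => by simpa using hcompat a

/-- When `κ₁ = κ[c]` (every element of `κ₁` is a polynomial in the chart point `c` over `ī(κ)`), `c` is ALGEBRAIC over `κ`:
a field is never a polynomial ring. -/
theorem isIntegral_chartPoint
    (hgen : ∀ b : ResidueField S₁, ∃ P : Polynomial (ResidueField S), b = P.eval₂ ((residue S₁).comp (φ.comp σ)) c) :
    letI := ((residue S₁).comp (φ.comp σ)).toAlgebra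
    IsIntegral (ResidueField S) c := by
  letI := ((residue S₁).comp (φ.comp σ)).toAlgebra
  rw [← isAlgebraic_iff_isIntegral]
  by_cases hc : c = 0
  · rw [hc]; exact isAlgebraic_zero
  obtain ⟨P, hP⟩ := hgen c⁻¹
  refine ⟨Polynomial.X * P - 1, ?_, ?_⟩
  · intro h0
    have := congrArg (fun q => Polynomial.coeff q 0) h0
    simp at this
  · rw [map_sub, map_one, map_mul, Polynomial.aeval_X, Polynomial.aeval_def,
      show algebraMap (ResidueField S) (ResidueField S₁) = (residue S₁).comp (φ.comp σ) from rfl, ← hP,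
      mul_inv_cancel₀ hc, sub_self]

/-- The lifted minimal polynomial of the chart point has the root `σ₁ c` under `φ` — EXACTLY, no Hensel lifting: `φ ∘ σ = σ₁ ∘ ī` and
`σ₁` is a ring map out of `κ₁ ∋ c`. -/
theorem eval₂_map_minpoly_chartPoint (hcompat : ∀ a, φ (σ a) = σ₁ (residue S₁ (φ (σ a)))) :
    letI := ((residue S₁).comp (φ.comp σ)).toAlgebra
    ((minpoly (ResidueField S) c).map σ).eval₂ φ (σ₁ c) = 0 := by
  letI := ((residue S₁).comp (φ.comp σ)).toAlgebra
  have hcomp := comp_section_eq_of_compat φ σ σ₁ hcompat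
  have key : ∀ q : Polynomial (ResidueField S),
      q.eval₂ (φ.comp σ) (σ₁ c) = σ₁ (Polynomial.aeval c q) := by
    intro q
    rw [hcomp, ← Polynomial.hom_eval₂, Polynomial.aeval_def]
    rfl
  rw [Polynomial.eval₂_map, key, minpoly.aeval, map_zero]

/-- **HatBaseChangeX, chart clauses** (generic modulus): for ANY monic irreducible `m ∈ κ[T]` whose `σ`-lift has the root `σ₁ c` under `φ`
(e.g. the minimal polynomial of the chart point, `eval₂_map_minpoly_chartPoint`), with `S′ = S[T]/(m̃)`, `ι = AdjoinRoot.of m̃`,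
`φ′ = AdjoinRoot.lift φ (σ₁ c)`, there is a compatible coefficient-field section `σ′` of `S′` such that: `φ′ ∘ ι = φ`, `ι` is local,
`(ι x, ι y, ι z, ι w) = 𝔪′`, `ι ∘ σ` lands in `σ′(κ′)`, `κ′` is algebraic over `S`, `residue₁ ∘ φ′ ∘ σ′ : κ′ → κ₁` is BIJECTIVE (`κ′ ≅ κ(c) = κ₁`),
`IsXChartHat φ′ σ′ σ₁ (ι x) (ι y) (ι z) (ι w) c v₁ z₁ w₁` (the SAME chart point), and the point is RATIONAL over `S′`. No Hensel lifting anywhere. OURS. -/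
theorem chart_clauses (hσ : ∀ a, residue S (σ a) = a) (hσ₁ : ∀ b, residue S₁ (σ₁ b) = b)
    (hcompat : ∀ a, φ (σ a) = σ₁ (residue S₁ (φ (σ a))))
    (hgen : ∀ b : ResidueField S₁, ∃ P : Polynomial (ResidueField S), b = P.eval₂ ((residue S₁).comp (φ.comp σ)) c)
    (hspan₁ : Ideal.span {φ x, v₁, z₁, w₁} = maximalIdeal S₁)
    (hy : φ y = φ x * (σ₁ c + v₁)) (hz : φ z = φ x * z₁) (hw : φ w = φ x * w₁)
    (hspan : Ideal.span {x, y, z, w} = maximalIdeal S)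
    (m : Polynomial (ResidueField S)) (hm : m.Monic) (hirr : Irreducible m) (hroot : (m.map σ).eval₂ φ (σ₁ c) = 0) :
    haveI := isLocalRing_adjoinRoot_section σ hσ m hm hirr
    ∃ σ' : ResidueField (AdjoinRoot (m.map σ)) →+* AdjoinRoot (m.map σ),
      (∀ b, residue _ (σ' b) = b) ∧
      (AdjoinRoot.lift φ (σ₁ c) hroot).comp (AdjoinRoot.of (m.map σ)) = φ ∧ IsLocalHom (AdjoinRoot.of (m.map σ)) ∧
      Ideal.span {AdjoinRoot.of (m.map σ) x, AdjoinRoot.of (m.map σ) y, AdjoinRoot.of (m.map σ) z, AdjoinRoot.of (m.map σ) w} =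
        maximalIdeal (AdjoinRoot (m.map σ)) ∧
      (∀ a : ResidueField S, AdjoinRoot.of (m.map σ) (σ a) = σ' (residue _ (AdjoinRoot.of (m.map σ) (σ a)))) ∧
      (∀ b : ResidueField (AdjoinRoot (m.map σ)), ∃ P : Polynomial S,
        Polynomial.map ((residue _).comp (AdjoinRoot.of (m.map σ))) P ≠ 0 ∧
        (Polynomial.map ((residue _).comp (AdjoinRoot.of (m.map σ))) P).eval b = 0) ∧
      Function.Bijective ((residue S₁).comp ((AdjoinRoot.lift φ (σ₁ c) hroot).comp σ')) ∧
      -- the eight clauses of `IsXChartHat φ′ σ′ σ₁ (ι x) (ι y) (ι z) (ι w) c v₁ z₁ w₁`, verbatim shape: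
      ((∀ a, residue _ (σ' a) = a) ∧ (∀ b, residue S₁ (σ₁ b) = b) ∧
        (∀ a, (AdjoinRoot.lift φ (σ₁ c) hroot) (σ' a) =
          σ₁ (residue S₁ ((AdjoinRoot.lift φ (σ₁ c) hroot) (σ' a)))) ∧
        (∀ b : ResidueField S₁, ∃ P : Polynomial (ResidueField (AdjoinRoot (m.map σ))),
          b = P.eval₂ ((residue S₁).comp ((AdjoinRoot.lift φ (σ₁ c) hroot).comp σ')) c) ∧
        Ideal.span {(AdjoinRoot.lift φ (σ₁ c) hroot) (AdjoinRoot.of (m.map σ) x), v₁, z₁, w₁} = maximalIdeal S₁ ∧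
        (AdjoinRoot.lift φ (σ₁ c) hroot) (AdjoinRoot.of (m.map σ) y) =
          (AdjoinRoot.lift φ (σ₁ c) hroot) (AdjoinRoot.of (m.map σ) x) * (σ₁ c + v₁) ∧
        (AdjoinRoot.lift φ (σ₁ c) hroot) (AdjoinRoot.of (m.map σ) z) =
          (AdjoinRoot.lift φ (σ₁ c) hroot) (AdjoinRoot.of (m.map σ) x) * z₁ ∧
        (AdjoinRoot.lift φ (σ₁ c) hroot) (AdjoinRoot.of (m.map σ) w) =
          (AdjoinRoot.lift φ (σ₁ c) hroot) (AdjoinRoot.of (m.map σ) x) * w₁) ∧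
      residue S₁ ((AdjoinRoot.lift φ (σ₁ c) hroot) (σ' (residue _ (AdjoinRoot.root (m.map σ))))) = c := by
  haveI := isLocalRing_adjoinRoot_section σ hσ m hm hirr
  have hmax := maximalIdeal_adjoinRoot_section σ hσ m hm hirr
  set ι := AdjoinRoot.of (m.map σ) with hι
  set φ' := AdjoinRoot.lift φ (σ₁ c) hroot with hφ'
  have hφ'ι : ∀ s, φ' (ι s) = φ s := fun s => AdjoinRoot.lift_of _
  have hφ'θ : φ' (AdjoinRoot.root (m.map σ)) = σ₁ c := AdjoinRoot.lift_root _
  obtain ⟨σ', hsec, hsecσ, hsecθ⟩ := exists_section_adjoinRoot σ hσ m hm hirr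
  obtain ⟨e, he_of, he_root⟩ := exists_residueField_ringEquiv σ hσ m hm hirr
  -- the residue map `Θ = residue₁ ∘ φ′ ∘ σ′ : κ′ → κ₁` and its values on generators
  set Θ : ResidueField (AdjoinRoot (m.map σ)) →+* ResidueField S₁ := (residue S₁).comp (φ'.comp σ') with hΘ
  have hΘσ : ∀ a : ResidueField S, Θ (residue _ (ι (σ a))) = residue S₁ (φ (σ a)) := by
    intro a
    change residue S₁ (φ' (σ' (residue _ (ι (σ a))))) = _
    rw [hsecσ, hφ'ι]
  have hΘθ : Θ (residue _ (AdjoinRoot.root (m.map σ))) = c := by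
    change residue S₁ (φ' (σ' (residue _ (AdjoinRoot.root (m.map σ))))) = c
    rw [hsecθ, hφ'θ, hσ₁]
  have hΘsurj : Function.Surjective Θ := by
    intro b
    obtain ⟨P, hP⟩ := hgen b
    refine ⟨P.eval₂ ((residue _).comp (ι.comp σ)) (residue _ (AdjoinRoot.root (m.map σ))), ?_⟩
    rw [Polynomial.hom_eval₂, hΘθ, hP]
    congr 1
    exact RingHom.ext fun a => hΘσ a
  have hΘbij : Function.Bijective Θ := ⟨Θ.injective, hΘsurj⟩
  refine ⟨σ', hsec, RingHom.ext hφ'ι, isLocalHom_of_section σ hσ m hm hirr, ?_, fun a => (hsecσ a).symm,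
    exists_polynomial_map_ne_zero_eval_eq_zero σ hσ m hm hirr, hΘbij, ?_, hΘθ⟩
  · -- `(ι x, ι y, ι z, ι w) = 𝔪′`
    rw [hmax, ← hspan, Ideal.map_span]
    simp only [Set.image_insert_eq, Set.image_singleton]
  · -- `IsXChartHat φ′ σ′ σ₁ (ι x) (ι y) (ι z) (ι w) c v₁ z₁ w₁`
    refine ⟨hsec, hσ₁, ?_, ?_, ?_, ?_, ?_, ?_⟩
    · -- coefficient-field compatibility `φ′ ∘ σ′ = σ₁ ∘ residue₁ ∘ φ′ ∘ σ′`, checked on the generators of `κ′ ≅ κ[T]/(m)`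
      have key : (φ'.comp σ').comp e.symm.toRingHom =
          ((σ₁.comp (residue S₁)).comp (φ'.comp σ')).comp e.symm.toRingHom := by
        apply Ideal.Quotient.ringHom_ext
        apply Polynomial.ringHom_ext
        · intro a
          have hea : e.symm (AdjoinRoot.of m a) = residue _ (ι (σ a)) := by
            rw [RingEquiv.symm_apply_eq, he_of, hσ]
          change φ' (σ' (e.symm (AdjoinRoot.mk m (Polynomial.C a)))) =
            σ₁ (residue S₁ (φ' (σ' (e.symm (AdjoinRoot.mk m (Polynomial.C a))))))
          rw [AdjoinRoot.mk_C, hea, hsecσ, hφ'ι, ← hcompat]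
        · have heX : e.symm (AdjoinRoot.root m) = residue _ (AdjoinRoot.root (m.map σ)) := by
            rw [RingEquiv.symm_apply_eq, he_root]
          change φ' (σ' (e.symm (AdjoinRoot.mk m Polynomial.X))) =
            σ₁ (residue S₁ (φ' (σ' (e.symm (AdjoinRoot.mk m Polynomial.X)))))
          rw [AdjoinRoot.mk_X, heX, hsecθ, hφ'θ, hσ₁]
      intro a
      have := congrArg (fun ψ : AdjoinRoot m →+* S₁ => ψ (e a)) key
      simpa using this
    · intro b
      obtain ⟨a, ha⟩ := hΘsurj b
      exact ⟨Polynomial.C a, by rw [Polynomial.eval₂_C, ← hΘ, ha]⟩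
    · rw [hφ'ι, hspan₁]
    · rw [hφ'ι, hφ'ι, hy]
    · rw [hφ'ι, hφ'ι, hz]
    · rw [hφ'ι, hφ'ι, hw]

end Chart

/-! ## §8 The hat-ring and stage-datum clauses; assembly -/

section Assembly
variable {S : Type} [CommRing S] [IsLocalRing S] (σ : ResidueField S →+* S) (hσ : ∀ a, residue S (σ a) = a)
  (m : Polynomial (ResidueField S))

include hσ in
/-- **`S` a hat ring ⇒ `S′ = S[T]/(m̃)` a hat ring**: Noetherian, regular, complete, of the same dimension, with perfect residue field
(the five clauses of the β-leaf word `IsHatRing`, unbundled). -/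
theorem hatRing_clauses_adjoinRoot_section [IsNoetherianRing S] [IsAdicComplete (maximalIdeal S) S] [PerfectField (ResidueField S)]
    (hreg : IsRegularLocalRing S) (hm : m.Monic) (hirr : Irreducible m) :
    haveI := isLocalRing_adjoinRoot_section σ hσ m hm hirr
    IsNoetherianRing (AdjoinRoot (m.map σ)) ∧ IsRegularLocalRing (AdjoinRoot (m.map σ)) ∧
      IsAdicComplete (maximalIdeal (AdjoinRoot (m.map σ))) (AdjoinRoot (m.map σ)) ∧
      ringKrullDim (AdjoinRoot (m.map σ)) = ringKrullDim S ∧ PerfectField (ResidueField (AdjoinRoot (m.map σ))) := by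
  haveI := isLocalRing_adjoinRoot_section σ hσ m hm hirr
  haveI := moduleFinite_adjoinRoot σ m hm
  exact ⟨inferInstance, isRegularLocalRing_adjoinRoot_section σ hσ m hreg hm hirr,
    isAdicComplete_adjoinRoot_section σ hσ m hm hirr, ringKrullDim_adjoinRoot_section σ m hm hirr.natDegree_pos,
    perfectField_residueField_adjoinRoot σ hσ m hm hirr⟩

/-- `S′ = S[T]/(m̃)` has the characteristic of `S` (monic modulus of positive degree: `ι` is injective). -/
theorem charP_adjoinRoot_section (p : ℕ) [CharP S p] (hm : m.Monic) (hdeg : 0 < m.natDegree) : CharP (AdjoinRoot (m.map σ)) p :=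
  charP_of_injective_ringHom (of_injective_of_monic (monic_map_section σ m hm) (by rwa [hm.natDegree_map σ])) p

/-- Reading a `2`-vector through a ring map. -/
theorem comp_vecCons₂ {A T : Type} [CommRing A] [CommRing T] (ι : A →+* T) (z w : A) : (ι ∘ ![z, w]) = ![ι z, ι w] := by
  funext i; fin_cases i <;> rfl

include hσ in
/-- **Transport of the stage congruence**: `f ≡ Ψ(z, w) (mod (x, y)·𝔪^(d−1) + 𝔪^(d+1))` in `S` gives the same congruence for `ι f` and `Ψ^ι`
in `S′` (because `𝔪′ = 𝔪·S′`). -/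
theorem stage_congruence_map (hm : m.Monic) (hirr : Irreducible m) (x y z w f : S) (d : ℕ) (Ψ : MvPolynomial (Fin 2) S)
    (hf : f - MvPolynomial.eval ![z, w] Ψ ∈ Ideal.span {x, y} * maximalIdeal S ^ (d - 1) ⊔ maximalIdeal S ^ (d + 1)) :
    haveI := isLocalRing_adjoinRoot_section σ hσ m hm hirr
    AdjoinRoot.of (m.map σ) f - MvPolynomial.eval ![AdjoinRoot.of (m.map σ) z, AdjoinRoot.of (m.map σ) w]
        (MvPolynomial.map (AdjoinRoot.of (m.map σ)) Ψ) ∈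
      Ideal.span {AdjoinRoot.of (m.map σ) x, AdjoinRoot.of (m.map σ) y} * maximalIdeal (AdjoinRoot (m.map σ)) ^ (d - 1) ⊔
        maximalIdeal (AdjoinRoot (m.map σ)) ^ (d + 1) := by
  haveI := isLocalRing_adjoinRoot_section σ hσ m hm hirr
  have hmax := maximalIdeal_adjoinRoot_section σ hσ m hm hirr
  have h := Ideal.mem_map_of_mem (AdjoinRoot.of (m.map σ)) hf
  rw [map_sub, MvPolynomial.eval₂_comp, comp_vecCons₂, ← MvPolynomial.eval_map, Ideal.map_sup, Ideal.map_mul, Ideal.map_pow,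
    Ideal.map_pow, Ideal.map_span, Set.image_insert_eq, Set.image_singleton, ← hmax] at h
  exact h

include hσ in
/-- **Anisotropy over `κ′` versus over `κ₁`**: along a ring ISOMORPHISM-onto `Θ : κ′ → κ₁` with `Θ ∘ residue′ ∘ ι = ī ∘ residue`
(`ī : κ → κ₁`), the reduction of `Ψ^ι` is anisotropic over `κ′` iff `Ψ̄ ⊗_ī κ₁` is anisotropic over `κ₁`. (Only «⇐» is used.) -/
theorem anisotropic_map_of_anisotropic_baseChange (hm : m.Monic) (hirr : Irreducible m) {κ₁ : Type} [Field κ₁]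
    (ibar : ResidueField S →+* κ₁)
    (Θ : (haveI := isLocalRing_adjoinRoot_section σ hσ m hm hirr; ResidueField (AdjoinRoot (m.map σ))) →+* κ₁)
    (hΘ : Function.Bijective Θ)
    (hΘι : ∀ s : S, Θ ((haveI := isLocalRing_adjoinRoot_section σ hσ m hm hirr; residue (AdjoinRoot (m.map σ)))
      (AdjoinRoot.of (m.map σ) s)) = ibar (residue S s))
    (Ψ : MvPolynomial (Fin 2) S)
    (han : ∀ a b : κ₁, (a ≠ 0 ∨ b ≠ 0) →
      MvPolynomial.eval ![a, b] (MvPolynomial.map (ibar.comp (residue S)) Ψ) ≠ 0) :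
    haveI := isLocalRing_adjoinRoot_section σ hσ m hm hirr
    ∀ a b : ResidueField (AdjoinRoot (m.map σ)), (a ≠ 0 ∨ b ≠ 0) →
      MvPolynomial.eval ![a, b] (MvPolynomial.map (residue (AdjoinRoot (m.map σ)))
        (MvPolynomial.map (AdjoinRoot.of (m.map σ)) Ψ)) ≠ 0 := by
  haveI := isLocalRing_adjoinRoot_section σ hσ m hm hirr
  intro a b hab hzero
  have hcomp : (Θ.comp (residue (AdjoinRoot (m.map σ)))).comp (AdjoinRoot.of (m.map σ)) = ibar.comp (residue S) :=
    RingHom.ext hΘι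
  have h := congrArg Θ hzero
  rw [map_zero, MvPolynomial.eval₂_comp, comp_vecCons₂, ← MvPolynomial.eval_map, MvPolynomial.map_map, MvPolynomial.map_map,
    hcomp] at h
  refine han (Θ a) (Θ b) ?_ h
  rcases hab with ha | hb
  · exact Or.inl fun h0 => ha (hΘ.1 (by rw [h0, map_zero]))
  · exact Or.inr fun h0 => hb (hΘ.1 (by rw [h0, map_zero]))

end Assembly

end Summit.ResolutionOfSingularities.ResolutionOfSingularities.Theorems.SwitchingDichotomy.HatBaseChange

end
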